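import Summits.KontsevichZagierPeriods.KontsevichZagierPeriods.Theses.CommonUnfolding
import Literature.NumberTheory.Transcendental.KZUnfolding

/-!
# `PeakNormalForm` (stmt-KontsevichZagierPeriods-4828, route CommonUnfolding, crux rank 2) — birth skeleton

Crux (the route file, verbatim up to the `let`s, which are `KZ.levelRel`, `KZ.Round` of
`Literature/NumberTheory/Transcendental/KZUnfolding.lean`): **single-peak normal form** — if two
integral representations `r` (dim `n`) and `r'` (dim `m`) are KZ-equivalent, then they have a COMMON
UNFOLDING: one representation `R` (the peak) and two chains of descent ROUNDS from `[R]` (a round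
massages the current formal sum by LEVEL moves — domain/integrand additivity and coordinate
permutations — into a sum of bands and replaces every band by its base through one Newton–Leibniz
instance), ending level-equivalent to `[r]`, resp. `[r']`.

## The line ("levelled congruence"; four registered stubs)

A KZ derivation of `[r] − [r']` is a `ℤ`-combination of move instances living in many dimensions at
once (rule 3) changes the dimension), while a common unfolding is a statement about ONE level. The
line first LEVELS the derivation, then reads it as a congruence generated by elementary steps on the
homogeneous layer `E_N = ⟨[s] : dim s = N⟩`, where "having a common unfolding" (`CUF`, stated for
formal sums) is an equivalence relation by the DIAMOND:

* `stub_levelling` (LEVELLING, size M): if `[r] − [r'] ∈ relations` then for some level `N` there are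
  iterated cylinders `R = r × [0,1]^{N−n}`, `R' = r' × [0,1]^{N−m}` — recorded only through what the
  composition needs: `[R] ⟶* [r]`, `[R'] ⟶* [r']` by rounds (peeling one cylinder coordinate per
  round, primitive `t·f`) — with `[R] − [R']` in the subgroup generated by the LEVEL-`N` move
  instances: domain additivity, integrand additivity and change of variables between dimension-`N`
  representations, and the levelled Newton–Leibniz move `[B] − [S]` (`B` a band over `b` with a
  semialgebraic fibrewise primitive, `S = b × [0,1]` the cylinder over the same base). Content:
  cylinders of move instances are move instances of level `N` (for rule 3) after one coordinate swap,
  which is a rule-2) instance); bookkeeping of `IntegralRep (N − d + d)` versus `IntegralRep N`.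
* `stub_unfoldingSteps` (ELEMENTARY STEPS UNFOLD IN CONTEXT, size L; takes crux 3
  `TransportElimination` BY NAME as its hypothesis): for every level-`N` move instance `g` and
  every homogeneous `u ∈ E_N`, `u` and `u − g` have a common unfolding. For additivity instances this is height `0` (`g ∈ levelRel`; needs only the MERGING
  lemma: every `u ∈ E_N` is level-equivalent to a single representation `[U]`, signs living in the
  integrand by `KZ.of_add_of_neg_mem_levelRel`); for `[B] − [S]` the peak is the cylinder over `B`
  (one round each side, the `S`-side after swapping the last two coordinates); for a change of
  variables it is exactly crux `TransportElimination` (stmt-4829) transported into the context `u`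
  (merge the context's cylinder with the peak). No new transcendence enters.
* `stub_transport` (= crux `TransportElimination`, stmt-KontsevichZagierPeriods-4829, cited BY NAME — its
  signature is literally the route decl, so it closes the moment stmt-4829 lands as
  `theorem stub_transport : TransportElimination := <the landed theorem>`; it is registered here only
  so that the skeleton theorem stays hypothesis-free, and it makes the route's dep
  `PeakNormalForm ⇐ TransportElimination` machine-visible instead of hiding rule 2) inside stub 2).
* `stub_diamond` (TRANSITIVITY = THE DIAMOND, size XL, the heart): common unfoldings of formal sums
  compose — two descents arriving at level-equivalent sums complete to a common peak one round up
  (crux `InterchangeLemma`, stmt-4830, is the `1 × 1` case; `k × l` interchange over a common base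
  partition, level lifts, grid induction; level-null middle terms are absorbed by padding, since a
  level-null sum keeps descending with the empty band family).

Composition `PeakNormalForm_of_stubs` (arrow form, sorry-free) / `PeakNormalForm_of : PeakNormalForm`
(by name, fed by the four stubs): from `stub_levelling` get `N, R, R'`; by
`AddSubgroup.closure_induction''` over the level-`N` generators prove
`∀ z ∈ ⟨levelGens N⟩, ∀ u v ∈ E_N, CUF u v → CUF u (v − z)` (a generator step is `stub_unfoldingSteps`
(fed `stub_transport`) at context `v` followed by `stub_diamond`; its negative is the step at context `v + g`, symmetry and
the diamond; sums compose because `⟨levelGens N⟩ ≤ E_N`); at `z = [R] − [R']`, `u = v = [R]` this is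
`CUF [R] [R']`; finally DESCENT EXTENSION (a chain of rounds out of a level-equivalent start is still a
chain of rounds: `Round` absorbs `levelRel` on the left) carries it down the two cylinder towers to
`CUF [r] [r']`, which is the crux's conclusion on the nose (`KZ.CommonUnfolding r r'`; the crux's
`let`s are `KZ.levelRel`, `KZ.Round` definitionally).

Disproof used: none on file for this crux (`ledger crux ls stmt-KontsevichZagierPeriods-4828`: no
Disproof.lean at registration). Dead lines: none recorded.
-/

namespace Summit.KontsevichZagierPeriods.KontsevichZagierPeriods.Cruxes.PeakNormalForm.Birth

open Literature.NumberTheory.Transcendental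
open Literature.NumberTheory.Transcendental.KZ
open Summit.KontsevichZagierPeriods.KontsevichZagierPeriods.Theses.CommonUnfolding (PeakNormalForm TransportElimination)

/-! ## Notions of the line (sorry-free definitions) -/

/-- The homogeneous layer `E_N`: formal sums of representations of dimension `N` only. -/
def Homog (N : ℕ) : AddSubgroup FormalRep :=
  AddSubgroup.closure (Set.range (of : IntegralRep N → FormalRep))

/-- The LEVELLED Newton–Leibniz move: `[B] − [S]` with `B` a band over `b` carrying a semialgebraic
fibrewise primitive (`[B] − [b] ∈ newtonLeibnizRel`) and `S = b × [0,1]` the cylinder over the same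
base (itself a Newton–Leibniz band over `b`, primitive `t · f`); both sides have dimension `d + 1`. -/
def cylBandRel : Set FormalRep :=
  {c | ∃ (d : ℕ) (B S : IntegralRep (d + 1)) (b : IntegralRep d),
    of B - of b ∈ newtonLeibnizRel ∧
    S.domain = {z | (Fin.init z : Fin d → ℝ) ∈ b.domain ∧ 0 ≤ z (Fin.last d) ∧ z (Fin.last d) ≤ 1} ∧
    (∀ z ∈ S.domain, S.integrand z = b.integrand (Fin.init z)) ∧ c = of B - of S}

/-- Level-`N` move instances: additivity (1a), (1b), change of variables (2) and the levelled
Newton–Leibniz move, between representations of dimension `N`. -/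
def levelGens (N : ℕ) : Set FormalRep :=
  (domainAddRel ∪ integrandAddRel ∪ changeOfVariablesRel ∪ cylBandRel) ∩ (Homog N : Set FormalRep)

/-- Common unfolding of two FORMAL SUMS: one peak `R`, two chains of rounds from `[R]`, ending
level-equivalent to `x`, resp. `y`. On generators `x = [r]`, `y = [r']` this is
`KZ.CommonUnfolding r r'` on the nose. -/
def CUF (x y : FormalRep) : Prop :=
  ∃ (M : ℕ) (R : IntegralRep M) (c c' : FormalRep),
    Relation.ReflTransGen Round (of R) c ∧ Relation.ReflTransGen Round (of R) c' ∧
    c - x ∈ levelRel ∧ c' - y ∈ levelRel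

/-! ## The registered stubs (statements spelled out over tree declarations) -/

/-- **Stub 1 — LEVELLING.** KZ-equivalent representations have cylinder towers `R ⟶* r`,
`R' ⟶* r'` of a common level `N` whose tops differ by a combination of LEVEL-`N` move instances
(additivity, change of variables, levelled Newton–Leibniz, all between dimension-`N`
representations). [size M; provable now] -/
theorem stub_levelling : ∀ ⦃n m : ℕ⦄ (r : KZ.IntegralRep n) (r' : KZ.IntegralRep m), KZ.Equivalent r r' → ∃ (N : ℕ) (R R' : KZ.IntegralRep N), Relation.ReflTransGen KZ.Round (KZ.of R) (KZ.of r) ∧ Relation.ReflTransGen KZ.Round (KZ.of R') (KZ.of r') ∧ KZ.of R - KZ.of R' ∈ AddSubgroup.closure ((KZ.domainAddRel ∪ KZ.integrandAddRel ∪ KZ.changeOfVariablesRel ∪ {c : KZ.FormalRep | ∃ (d : ℕ) (B S : KZ.IntegralRep (d + 1)) (b : KZ.IntegralRep d), KZ.of B - KZ.of b ∈ KZ.newtonLeibnizRel ∧ S.domain = {z | (Fin.init z : Fin d → ℝ) ∈ b.domain ∧ 0 ≤ z (Fin.last d) ∧ z (Fin.last d) ≤ 1} ∧ (∀ z ∈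 S.domain, S.integrand z = b.integrand (Fin.init z)) ∧ c = KZ.of B - KZ.of S}) ∩ (↑(AddSubgroup.closure (Set.range (KZ.of : KZ.IntegralRep N → KZ.FormalRep))) : Set KZ.FormalRep)) := by
  sorry

/-- **Stub 2 — ELEMENTARY STEPS UNFOLD IN CONTEXT (given crux 3 by name).** Assuming
`TransportElimination` (stmt-KontsevichZagierPeriods-4829: the two sides of a change-of-variables
instance have a common unfolding), for every level-`N` move instance `g` and every homogeneous formal
sum `u` of dimension `N`, `u` and `u − g` have a common unfolding. (Additivity instances: height `0`
by MERGING — every `u ∈ E_N` is level-equivalent to one representation; levelled Newton–Leibniz: the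
cylinder over the band is the peak, the `S`-side after swapping the last two coordinates; change of
variables: the hypothesis, transported into the context `u` by padding the context with cylinders and
merging it with the peak.) [size L] -/
theorem stub_unfoldingSteps : Summit.KontsevichZagierPeriods.KontsevichZagierPeriods.Theses.CommonUnfolding.TransportElimination → ∀ (N : ℕ) (g u : KZ.FormalRep), g ∈ (KZ.domainAddRel ∪ KZ.integrandAddRel ∪ KZ.changeOfVariablesRel ∪ {c : KZ.FormalRep | ∃ (d : ℕ) (B S : KZ.IntegralRep (d + 1)) (b : KZ.IntegralRep d), KZ.of B - KZ.of b ∈ KZ.newtonLeibnizRel ∧ S.domain = {z | (Fin.init z : Fin d → ℝ) ∈ b.domain ∧ 0 ≤ z (Fin.last d) ∧ z (Fin.last d) ≤ 1} ∧ (∀ z ∈ S.domain, S.integrand z = b.integrand (Fin.init z)) ∧ c = KZ.of B - KZ.of S}) ∩ (↑(AddSubgroup.closure (Set.range (KZ.of : KZ.IntegralRep N → KZ.FormalRep))) : Set KZ.FormalRep) → u ∈ AddSubgroup.closure (Set.range (KZ.of : KZ.IntegralRep N → KZ.FormalRep)) → ∃ (M : ℕ) (R : KZ.IntegralRep M) (c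 c' : KZ.FormalRep), Relation.ReflTransGen KZ.Round (KZ.of R) c ∧ Relation.ReflTransGen KZ.Round (KZ.of R) c' ∧ c - u ∈ KZ.levelRel ∧ c' - (u - g) ∈ KZ.levelRel := by
  sorry

/-- **Stub 3 — RULE 2) UNFOLDS = crux `TransportElimination` (stmt-KontsevichZagierPeriods-4829), BY
NAME.** Registered as a stub only to keep `PeakNormalForm_of` hypothesis-free; it is the route's
declared dependency, not new work: prove stmt-4829 (staffed on its own) and this stub is the one-liner
`theorem stub_transport : TransportElimination := <landed theorem>`. [size L = stmt-4829; 0 beyond it] -/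
theorem stub_transport : Summit.KontsevichZagierPeriods.KontsevichZagierPeriods.Theses.CommonUnfolding.TransportElimination := by
  sorry

/-- **Stub 4 — THE DIAMOND (transitivity of common unfoldings of formal sums).** Two descents
arriving at level-equivalent sums complete to a common peak (crux `InterchangeLemma`,
stmt-KontsevichZagierPeriods-4830, is the one-band case; `k × l` interchange, level lifts, grid
induction; level-null middles absorbed by padding). NB for the prover: the STRICT one-round /
one-round diamond is false at a level-null valley bottom joining tops of different dimensions
(`R₁ = [[0,1]², 2t − 1]`, `R₂ = [[0,1]³, 3u² − 1]`, both one round above `≡ 0`); transitivity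
survives because a round out of a level-null node may restart in ANY dimension (`[R₂] ⟶ [[0,1]², 0]
⟶ [[0,1]², 2t] + [[0,1]², −1] ≡ [R₁]`, bands `[cube, 2t]` and `[cube, 2u].neg`, a permutation pair) —
so aim for semi-confluence (`Relation.church_rosser` shape), not the strict diamond.
[size XL; the heart of the crux] -/
theorem stub_diamond : ∀ (x y z : KZ.FormalRep), (∃ (M : ℕ) (R : KZ.IntegralRep M) (c c' : KZ.FormalRep), Relation.ReflTransGen KZ.Round (KZ.of R) c ∧ Relation.ReflTransGen KZ.Round (KZ.of R) c' ∧ c - x ∈ KZ.levelRel ∧ c' - y ∈ KZ.levelRel) → (∃ (M : ℕ) (R : KZ.IntegralRep M) (c c' : KZ.FormalRep), Relation.ReflTransGen KZ.Round (KZ.of R) c ∧ Relation.ReflTransGen KZ.Round (KZ.of R) c' ∧ c - y ∈ KZ.levelRel ∧ c' - z ∈ KZ.levelRel) → ∃ (M : ℕ) (R : KZ.IntegralRep M) (c c' : KZ.FormalRep), Relation.ReflTransGen KZ.Round (KZ.of R) c ∧ Relation.ReflTransGen KZ.Round (KZ.of R) c' ∧ c - x ∈ KZ.levelRel ∧ c'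 - z ∈ KZ.levelRel := by
  sorry

/-! ## The stubs read over the notions of the line (definitional, `example`s) -/

example : ∀ ⦃n m : ℕ⦄ (r : IntegralRep n) (r' : IntegralRep m), Equivalent r r' →
    ∃ (N : ℕ) (R R' : IntegralRep N), Relation.ReflTransGen Round (of R) (of r) ∧
      Relation.ReflTransGen Round (of R') (of r') ∧
      of R - of R' ∈ AddSubgroup.closure (levelGens N) := stub_levelling

example : TransportElimination →
    ∀ (N : ℕ) (g u : FormalRep), g ∈ levelGens N → u ∈ Homog N → CUF u (u - g) :=
  stub_unfoldingSteps

example : TransportElimination := stub_transport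

/-- `TransportElimination` read over the notions of the line: its inlined `let`s are `KZ.levelRel`,
`KZ.Round` definitionally, so it hands the stub-2 prover `CUF [s] [s']` for every rule-2) pair on the
nose (defeq sanity check, sorry-free). -/
example (hT : TransportElimination) {n : ℕ} (s s' : IntegralRep n)
    (h : of s - of s' ∈ changeOfVariablesRel) : CUF (of s) (of s') :=
  hT s s' h

example : ∀ (x y z : FormalRep), CUF x y → CUF y z → CUF x z := stub_diamond

/-! ## Glue (sorry-free) -/

section Glue

variable {N : ℕ}

/-- `CUF` is symmetric (swap the two descents). -/
theorem CUF.symm {x y : FormalRep} (h : CUF x y) : CUF y x := by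
  obtain ⟨M, R, c, c', hc, hc', hx, hy⟩ := h
  exact ⟨M, R, c', c, hc', hc, hy, hx⟩

/-- A single representation is its own peak. -/
theorem CUF.refl_of {M : ℕ} (R : IntegralRep M) : CUF (of R) (of R) :=
  ⟨M, R, of R, of R, Relation.ReflTransGen.refl, Relation.ReflTransGen.refl,
    by rw [sub_self]; exact levelRel.zero_mem, by rw [sub_self]; exact levelRel.zero_mem⟩

/-- Rounds absorb level moves on the left: a round out of `C` is a round out of any `C'`
level-equivalent to `C`. -/
theorem round_of_sub_mem_levelRel {C C' c : FormalRep} (h : Round C c) (hC : C' - C ∈ levelRel) :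
    Round C' c := by
  obtain ⟨d, k, B, b, hNL, hB, rfl⟩ := h
  refine ⟨d, k, B, b, hNL, ?_, rfl⟩
  have key : C' - ∑ i, of (B i) = (C' - C) + (C - ∑ i, of (B i)) := by abel
  rw [key]
  exact levelRel.add_mem hC hB

/-- DESCENT EXTENSION on the left: continuing the first descent of a common unfolding by a chain of
rounds (read through the level-equivalence at its end) is again a common unfolding. -/
theorem CUF.descend_left {x x₁ y : FormalRep} (h : CUF x y)
    (hx : Relation.ReflTransGen Round x x₁) : CUF x₁ y := by
  obtain ⟨M, R, c, c', hc, hc', hcx, hc'y⟩ := h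
  rcases hx.cases_head with rfl | ⟨w, hxw, hwx₁⟩
  · exact ⟨M, R, c, c', hc, hc', hcx, hc'y⟩
  · have hcw : Round c w := round_of_sub_mem_levelRel hxw hcx
    exact ⟨M, R, x₁, c', (hc.tail hcw).trans hwx₁, hc',
      by rw [sub_self]; exact levelRel.zero_mem, hc'y⟩

/-- Descent extension on both sides. -/
theorem CUF.descend {x x₁ y y₁ : FormalRep} (h : CUF x y)
    (hx : Relation.ReflTransGen Round x x₁) (hy : Relation.ReflTransGen Round y y₁) :
    CUF x₁ y₁ :=
  ((h.descend_left hx).symm.descend_left hy).symm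

/-- Generators of dimension `N` are homogeneous of dimension `N`. -/
theorem of_mem_homog (s : IntegralRep N) : of s ∈ Homog N :=
  AddSubgroup.subset_closure ⟨s, rfl⟩

/-- Level-`N` move instances are homogeneous of dimension `N` (by definition). -/
theorem levelGens_subset_homog : levelGens N ⊆ (Homog N : Set FormalRep) :=
  Set.inter_subset_right

/-- Hence so is the subgroup they generate. -/
theorem closure_levelGens_le : AddSubgroup.closure (levelGens N) ≤ Homog N :=
  (AddSubgroup.closure_le _).mpr levelGens_subset_homog

/-- **The congruence.** Given the elementary steps in context and the diamond, every element `z`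
of the subgroup generated by the level-`N` move instances can be subtracted on the right of any
common unfolding inside the layer `E_N`. Closure induction: a generator `g` is the step at context
`v` followed by the diamond; `−g` is the step at context `v + g`, symmetry, and the diamond; `0` and
sums are bookkeeping (sums stay in `E_N` because `⟨levelGens N⟩ ≤ E_N`). -/
theorem cuf_sub_of_mem_closure
    (hS : ∀ (N : ℕ) (g u : FormalRep), g ∈ levelGens N → u ∈ Homog N → CUF u (u - g))
    (hD : ∀ (x y z : FormalRep), CUF x y → CUF y z → CUF x z) (N : ℕ)
    {z : FormalRep} (hz : z ∈ AddSubgroup.closure (levelGens N)) :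
    ∀ u v : FormalRep, u ∈ Homog N → v ∈ Homog N → CUF u v → CUF u (v - z) := by
  refine AddSubgroup.closure_induction'' (p := fun z _ =>
      ∀ u v : FormalRep, u ∈ Homog N → v ∈ Homog N → CUF u v → CUF u (v - z)) ?_ ?_ ?_ ?_ hz
  · -- a generator: step at context `v`, then the diamond
    intro g hg u v _ hv huv
    exact hD u v (v - g) huv (hS N g v hg hv)
  · -- the negative of a generator: step at context `v + g`, symmetry, diamond
    intro g hg u v _ hv huv
    have hvg : v + g ∈ Homog N := add_mem hv (levelGens_subset_homog hg)
    have step : CUF (v + g) (v + g - g) := hS N g (v + g) hg hvg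
    rw [add_sub_cancel_right] at step
    have key : CUF u (v + g) := hD u v (v + g) huv step.symm
    rwa [sub_neg_eq_add]
  · -- zero
    intro u v _ _ huv
    rwa [sub_zero]
  · -- sums
    intro z₁ z₂ hz₁ _ ih₁ ih₂ u v hu hv huv
    have h₁ : CUF u (v - z₁) := ih₁ u v hu hv huv
    have hvz : v - z₁ ∈ Homog N := sub_mem hv (closure_levelGens_le hz₁)
    have h₂ : CUF u (v - z₁ - z₂) := ih₂ u (v - z₁) hu hvz h₁
    rwa [sub_add_eq_sub_sub]

/-- **Single-peak normal form from the stubs**, concluding `KZ.CommonUnfolding` (the crux's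
conclusion over the landed definitions): level, run the congruence at `z = [R] − [R']`,
`u = v = [R]`, and extend both descents down the cylinder towers. -/
theorem commonUnfolding_of_equivalent
    (hL : ∀ ⦃n m : ℕ⦄ (r : IntegralRep n) (r' : IntegralRep m), Equivalent r r' →
      ∃ (N : ℕ) (R R' : IntegralRep N), Relation.ReflTransGen Round (of R) (of r) ∧
        Relation.ReflTransGen Round (of R') (of r') ∧
        of R - of R' ∈ AddSubgroup.closure (levelGens N))
    (hS : ∀ (N : ℕ) (g u : FormalRep), g ∈ levelGens N → u ∈ Homog N → CUF u (u - g))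
    (hD : ∀ (x y z : FormalRep), CUF x y → CUF y z → CUF x z)
    {n m : ℕ} (r : IntegralRep n) (r' : IntegralRep m) (h : Equivalent r r') :
    CommonUnfolding r r' := by
  obtain ⟨N, R, R', hR, hR', hrel⟩ := hL r r' h
  have key := cuf_sub_of_mem_closure hS hD N hrel (of R) (of R) (of_mem_homog R) (of_mem_homog R)
    (CUF.refl_of R)
  rw [sub_sub_cancel] at key
  exact key.descend hR hR'

end Glue

/-! ## The composition -/

/-- **Composition, arrow form** (kernel-checked, sorry-free): the four stub statements, verbatim,
imply the crux statement — written out as `KZ.Equivalent r r' → KZ.CommonUnfolding r r'`, which is the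
body of `PeakNormalForm` once its inlined `let`s are read as `KZ.levelRel`, `KZ.Round` (definitional;
`PeakNormalForm_of` below performs exactly that conversion and nothing else). -/
theorem PeakNormalForm_of_stubs
    (h₁ : ∀ ⦃n m : ℕ⦄ (r : KZ.IntegralRep n) (r' : KZ.IntegralRep m), KZ.Equivalent r r' → ∃ (N : ℕ) (R R' : KZ.IntegralRep N), Relation.ReflTransGen KZ.Round (KZ.of R) (KZ.of r) ∧ Relation.ReflTransGen KZ.Round (KZ.of R') (KZ.of r') ∧ KZ.of R - KZ.of R' ∈ AddSubgroup.closure ((KZ.domainAddRel ∪ KZ.integrandAddRel ∪ KZ.changeOfVariablesRel ∪ {c : KZ.FormalRep | ∃ (d : ℕ) (B S : KZ.IntegralRep (d + 1)) (b : KZ.IntegralRep d), KZ.of B - KZ.of b ∈ KZ.newtonLeibnizRel ∧ S.domain = {z | (Fin.init z : Fin d → ℝ) ∈ b.domain ∧ 0 ≤ z (Fin.last d) ∧ z (Fin.last d) ≤ 1} ∧ (∀ z ∈ S.domain, S.integrand z = b.integrand (Fin.init z)) ∧ c = KZ.of B - KZ.of S}) ∩ (↑(AddSubgroup.closure (Set.range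 (KZ.of : KZ.IntegralRep N → KZ.FormalRep))) : Set KZ.FormalRep)))
    (h₂ : Summit.KontsevichZagierPeriods.KontsevichZagierPeriods.Theses.CommonUnfolding.TransportElimination → ∀ (N : ℕ) (g u : KZ.FormalRep), g ∈ (KZ.domainAddRel ∪ KZ.integrandAddRel ∪ KZ.changeOfVariablesRel ∪ {c : KZ.FormalRep | ∃ (d : ℕ) (B S : KZ.IntegralRep (d + 1)) (b : KZ.IntegralRep d), KZ.of B - KZ.of b ∈ KZ.newtonLeibnizRel ∧ S.domain = {z | (Fin.init z : Fin d → ℝ) ∈ b.domain ∧ 0 ≤ z (Fin.last d) ∧ z (Fin.last d) ≤ 1} ∧ (∀ z ∈ S.domain, S.integrand z = b.integrand (Fin.init z)) ∧ c = KZ.of B - KZ.of S}) ∩ (↑(AddSubgroup.closure (Set.range (KZ.of : KZ.IntegralRep N → KZ.FormalRep))) : Set KZ.FormalRep) → u ∈ AddSubgroup.closure (Set.range (KZ.of : KZ.IntegralRep N → KZ.FormalRep)) → ∃ (M : ℕ) (R : KZ.IntegralRep M) (c c' : KZ.FormalRep), Relation.ReflTransGen KZ.Round (KZ.of R) c ∧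 Relation.ReflTransGen KZ.Round (KZ.of R) c' ∧ c - u ∈ KZ.levelRel ∧ c' - (u - g) ∈ KZ.levelRel)
    (hT : Summit.KontsevichZagierPeriods.KontsevichZagierPeriods.Theses.CommonUnfolding.TransportElimination)
    (h₃ : ∀ (x y z : KZ.FormalRep), (∃ (M : ℕ) (R : KZ.IntegralRep M) (c c' : KZ.FormalRep), Relation.ReflTransGen KZ.Round (KZ.of R) c ∧ Relation.ReflTransGen KZ.Round (KZ.of R) c' ∧ c - x ∈ KZ.levelRel ∧ c' - y ∈ KZ.levelRel) → (∃ (M : ℕ) (R : KZ.IntegralRep M) (c c' : KZ.FormalRep), Relation.ReflTransGen KZ.Round (KZ.of R) c ∧ Relation.ReflTransGen KZ.Round (KZ.of R) c' ∧ c - y ∈ KZ.levelRel ∧ c' - z ∈ KZ.levelRel) → ∃ (M : ℕ) (R : KZ.IntegralRep M) (c c' : KZ.FormalRep), Relation.ReflTransGen KZ.Round (KZ.of R) c ∧ Relation.ReflTransGen KZ.Round (KZ.of R) c' ∧ c - x ∈ KZ.levelRel ∧ c' - z ∈ KZ.levelRel) :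
    ∀ ⦃n m : ℕ⦄ (r : KZ.IntegralRep n) (r' : KZ.IntegralRep m),
      KZ.Equivalent r r' → KZ.CommonUnfolding r r' :=
  fun _ _ r r' h => commonUnfolding_of_equivalent h₁ (h₂ hT) h₃ r r' h

/-- **Skeleton theorem** (concludes the crux BY NAME): `PeakNormalForm` from the four registered
stubs through the sorry-free composition `PeakNormalForm_of_stubs`; the only `sorry`s of this file sit
inside `stub_levelling`, `stub_unfoldingSteps`, `stub_transport`, `stub_diamond`. -/
theorem PeakNormalForm_of : PeakNormalForm := by
  intro n m r r' h
  exact PeakNormalForm_of_stubs stub_levelling stub_unfoldingSteps stub_transport stub_diamond r r' h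

end Summit.KontsevichZagierPeriods.KontsevichZagierPeriods.Cruxes.PeakNormalForm.Birth
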